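import Literature.Computability.Complexity.SymmetricCircuitPlug

/-!
# Symmetric circuits are closed under post-composition with general circuits

Continuation of `SymmetricCircuitPlug.lean` (Anderson–Dawar 2017, §2; the "general circuit on
invariant wires stays symmetric" idiom of every upper-bound construction for symmetric circuits with
a symmetry budget — Dawar–Wilsenach, ToC 21 (2025), §3; written by the cdisprove seat of crux
`stmt-PneNP-2143`, route `PneNP/SymmetryBudget`):
* `GateList.SymFix Γ gs W` — a program on `m × m` matrix inputs with automorphisms (extending every
  `ρ ∈ Γ`, diagonal action) that FIX a set `W` of wires; closed under laying a `Γ`-symmetric circuit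
  beside it (`SymFix.plug_symmetric`; the new output joins `W`) and under plugging a GENERAL circuit
  on wires of `W` (`SymFix.plug_general`); read at a wire of `W` it is a `Γ`-symmetric circuit
  (`SymFix.isSymmetricUnder_toCircuit`);
* `GateList.symLayer` — circuits laid one after another, fed from the inputs (`carries_symLayer`,
  `symFix_symLayer`, …);
* `hasSymCircuit_postcompose` — if `C i` (`i < r`) are `Γ`-symmetric circuits over `B` with `≤ s`
  gates computing `f i` and `D` is ANY circuit over `B` on `r` inputs computing `h`, then
  `x ↦ h (f₀ x, …)` has a `Γ`-symmetric circuit over `B` with `≤ r * s + |D|` gates (automorphism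
  `σ₀ ⊕ ⋯ ⊕ σ_{r-1} ⊕ id`).
-/

namespace Literature.Computability.Complexity.GateList

open Literature.Computability.Complexity

/-! ### Symmetric programs with fixed wires -/

section Compose

variable {m : ℕ}

/-- The diagonal action of a vertex permutation on matrix entries. [folklore] -/
def act (ρ : Equiv.Perm (Fin m)) : Fin m × Fin m → Fin m × Fin m := fun q => (ρ q.1, ρ q.2)

/-- `SymFix Γ gs W`: the wires of `W` are valid in the program `gs`, and every `ρ ∈ Γ` (acting
diagonally on the matrix inputs) extends to an automorphism of `gs` FIXING every wire of `W`
("invariant wires": outputs of symmetric sub-circuits, wires of post-processors). [folklore] -/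
def SymFix (Γ : Set (Equiv.Perm (Fin m))) (gs : List (Gate (Fin m × Fin m)))
    (W : Set ((Fin m × Fin m) ⊕ ℕ)) : Prop :=
  (∀ w ∈ W, OutOK gs.length w) ∧
    ∀ ρ ∈ Γ, ∃ σ : Equiv.Perm (Fin gs.length), ListAut gs (act ρ) σ ∧
      ∀ w ∈ W, Circuit.relabelWire (act ρ) σ w = w

variable {Γ : Set (Equiv.Perm (Fin m))}

/-- The empty program is symmetric, with no fixed wires. [folklore] -/
theorem symFix_nil : SymFix Γ ([] : List (Gate (Fin m × Fin m))) ∅ :=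
  ⟨fun _ h => h.elim, fun _ _ => ⟨1, ⟨fun j => j.elim0⟩, fun _ h => h.elim⟩⟩

/-- Fewer fixed wires. [folklore] -/
theorem SymFix.mono {gs : List (Gate (Fin m × Fin m))} {W W' : Set ((Fin m × Fin m) ⊕ ℕ)}
    (h : SymFix Γ gs W) (hW : W' ⊆ W) : SymFix Γ gs W' :=
  ⟨fun w hw => h.1 w (hW hw), fun ρ hρ => by
    obtain ⟨σ, hσ, hfix⟩ := h.2 ρ hρ
    exact ⟨σ, hσ, fun w hw => hfix w (hW hw)⟩⟩

/-- A valid wire stays valid in a longer program. [folklore] -/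
theorem outOK_of_le {L L' : ℕ} {w : (Fin m × Fin m) ⊕ ℕ} (h : OutOK L w) (hL : L ≤ L') :
    OutOK L' w := fun k hk => (h k hk).trans_le hL

/-- **Laying a symmetric circuit beside a symmetric program.** Plug a `Γ`-symmetric circuit `C`
behind `gs`, its inputs fed from the actual inputs: the result is symmetric, the old fixed wires
stay fixed, and the (relocated) output of `C` is a new fixed wire. [folklore] -/
theorem SymFix.plug_symmetric {gs : List (Gate (Fin m × Fin m))} {W : Set ((Fin m × Fin m) ⊕ ℕ)}
    (hwf : WF gs) (h : SymFix Γ gs W) {C : Circuit (Fin m × Fin m)} (hC : C.IsSymmetricUnder Γ) :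
    SymFix Γ (plug gs Sum.inl C).1 (W ∪ {(plug gs Sum.inl C).2}) := by
  have hlen : gs.length ≤ (plug gs Sum.inl C).1.length := by rw [length_plug]; omega
  have hout : OutOK (plug gs Sum.inl C).1.length (plug gs Sum.inl C).2 :=
    outOK_plug_snd (wiresOK_inl gs.length id)
  refine ⟨fun w hw => ?_, fun ρ hρ => ?_⟩
  · rcases hw with hw | hw
    · exact outOK_of_le (h.1 w hw) hlen
    · rw [Set.mem_singleton_iff] at hw; subst hw; exact hout
  · obtain ⟨σ, hσ, hfix⟩ := h.2 ρ hρ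
    obtain ⟨σC, hσC⟩ := hC ρ hρ
    have hρw : ∀ k : Fin m × Fin m, Circuit.relabelWire (act ρ) σ (Sum.inl k) = Sum.inl (act ρ k) :=
      fun k => rfl
    refine ⟨plugPerm σ σC, listAut_plug hwf hσ hσC hρw (wiresOK_inl gs.length id), fun w hw => ?_⟩
    rcases hw with hw | hw
    · rw [relabelWire_plug_old (h.1 w hw)]; exact hfix w hw
    · rw [Set.mem_singleton_iff] at hw; subst hw
      exact relabelWire_plug_output hσC hρw (wiresOK_inl gs.length id)

/-- **Post-composing a GENERAL circuit on fixed wires.** Plug an arbitrary circuit `D` (inputs `κ`)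
behind `gs`, feeding input `k` from a FIXED wire `ρD k ∈ W`: the result is symmetric (the
automorphism is the identity on the block of `D`), and the output of `D` is a new fixed wire. [folklore] -/
theorem SymFix.plug_general {κ : Type*} {gs : List (Gate (Fin m × Fin m))}
    {W : Set ((Fin m × Fin m) ⊕ ℕ)} (hwf : WF gs) (h : SymFix Γ gs W) (D : Circuit κ)
    {ρD : κ → (Fin m × Fin m) ⊕ ℕ} (hρD : ∀ k, ρD k ∈ W) :
    SymFix Γ (plug gs ρD D).1 (W ∪ {(plug gs ρD D).2}) := by
  have hOK : WiresOK gs.length ρD := fun k n hn => h.1 (ρD k) (hρD k) n hn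
  have hlen : gs.length ≤ (plug gs ρD D).1.length := by rw [length_plug]; omega
  have hout : OutOK (plug gs ρD D).1.length (plug gs ρD D).2 := outOK_plug_snd hOK
  refine ⟨fun w hw => ?_, fun ρ hρ => ?_⟩
  · rcases hw with hw | hw
    · exact outOK_of_le (h.1 w hw) hlen
    · rw [Set.mem_singleton_iff] at hw; subst hw; exact hout
  · obtain ⟨σ, hσ, hfix⟩ := h.2 ρ hρ
    have hρw : ∀ k, Circuit.relabelWire (act ρ) σ (ρD k) = ρD (id k) := fun k => hfix _ (hρD k)
    refine ⟨plugPerm σ 1, listAut_plug hwf hσ D.isInducedAut_id_one hρw hOK, fun w hw => ?_⟩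
    rcases hw with hw | hw
    · rw [relabelWire_plug_old (h.1 w hw)]; exact hfix w hw
    · rw [Set.mem_singleton_iff] at hw; subst hw
      exact relabelWire_plug_output D.isInducedAut_id_one hρw hOK

/-- **Extraction**: a symmetric program read at a fixed wire is a `Γ`-symmetric circuit. [folklore] -/
theorem SymFix.isSymmetricUnder_toCircuit {gs : List (Gate (Fin m × Fin m))}
    {W : Set ((Fin m × Fin m) ⊕ ℕ)} (h : SymFix Γ gs W) {u : (Fin m × Fin m) ⊕ ℕ} (hu : u ∈ W)
    (hwf : WF gs) : (toCircuit gs u hwf (h.1 u hu)).IsSymmetricUnder Γ := by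
  intro ρ hρ
  obtain ⟨σ, hσ, hfix⟩ := h.2 ρ hρ
  exact ⟨σ, hfix u hu, hσ.out⟩

end Compose

/-! ### A layer of symmetric circuits, then a general post-processor -/

section Layer

variable {m : ℕ} {Γ : Set (Equiv.Perm (Fin m))}

/-- Lay the circuits `Cs` one after another, each fed from the actual inputs; return the program
and the list of their relocated output wires. [folklore] -/
def symLayer (Cs : List (Circuit (Fin m × Fin m))) :
    List (Gate (Fin m × Fin m)) × List ((Fin m × Fin m) ⊕ ℕ) :=
  Cs.foldl (fun P C => ((plug P.1 Sum.inl C).1, P.2 ++ [(plug P.1 Sum.inl C).2])) ([], [])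

/-- `symLayer` on a snoc. [folklore] -/
theorem symLayer_concat (Cs : List (Circuit (Fin m × Fin m))) (C : Circuit (Fin m × Fin m)) :
    symLayer (Cs ++ [C]) =
      ((plug (symLayer Cs).1 Sum.inl C).1, (symLayer Cs).2 ++ [(plug (symLayer Cs).1 Sum.inl C).2]) := by
  simp [symLayer, List.foldl_append]

/-- The layer is well formed. [folklore] -/
theorem wf_symLayer (Cs : List (Circuit (Fin m × Fin m))) : WF (symLayer Cs).1 := by
  induction Cs using List.reverseRecOn with
  | nil => exact WF.nil
  | append_singleton Cs C ih =>
    rw [symLayer_concat]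
    exact wf_plug ih (wiresOK_inl _ id) C

/-- The gates of the layer are gates of its circuits. [folklore] -/
theorem fn_mem_symLayer {B : Set GateFn} (Cs : List (Circuit (Fin m × Fin m)))
    (hB : ∀ C ∈ Cs, C.IsOver B) : ∀ g ∈ (symLayer Cs).1, g.fn ∈ B := by
  induction Cs using List.reverseRecOn with
  | nil => intro g hg; simp [symLayer] at hg
  | append_singleton Cs C ih =>
    rw [symLayer_concat]
    exact fn_mem_plug (ih fun C' hC' => hB C' (List.mem_append_left _ hC')) _
      (hB C (List.mem_append_right _ (List.mem_singleton_self _)))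

/-- The layer has as many gates as its circuits together. [folklore] -/
theorem length_symLayer_fst (Cs : List (Circuit (Fin m × Fin m))) :
    (symLayer Cs).1.length = (Cs.map Circuit.size).sum := by
  induction Cs using List.reverseRecOn with
  | nil => simp [symLayer]
  | append_singleton Cs C ih =>
    rw [symLayer_concat, length_plug, ih]
    simp

/-- One output wire per circuit. [folklore] -/
theorem length_symLayer_snd (Cs : List (Circuit (Fin m × Fin m))) :
    (symLayer Cs).2.length = Cs.length := by
  induction Cs using List.reverseRecOn with
  | nil => simp [symLayer]
  | append_singleton Cs C ih =>
    rw [symLayer_concat]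
    simp [ih]

/-- **Semantics of the layer**: the `k`-th output wire carries the `k`-th circuit. [folklore] -/
theorem carries_symLayer (Cs : List (Circuit (Fin m × Fin m))) (k : ℕ) (hk : k < Cs.length)
    (hk' : k < (symLayer Cs).2.length) :
    Carries (symLayer Cs).1 ((symLayer Cs).2[k]) (Cs[k]).eval (Cs[k]).acDepth := by
  induction Cs using List.reverseRecOn generalizing k with
  | nil => exact absurd hk (Nat.not_lt_zero _)
  | append_singleton Cs C ih =>
    have hlen2 : (symLayer Cs).2.length = Cs.length := length_symLayer_snd Cs
    rw [List.length_append, List.length_singleton] at hk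
    by_cases hkC : k < Cs.length
    · -- an earlier output survives the plug
      have e1 : (symLayer (Cs ++ [C])).2[k]'hk' = (symLayer Cs).2[k]'(by rw [hlen2]; exact hkC) := by
        simp only [symLayer_concat]
        exact List.getElem_append_left (by rw [hlen2]; exact hkC)
      have e2 : (Cs ++ [C])[k]'(by simp; omega) = Cs[k] := List.getElem_append_left hkC
      rw [e1, e2]
      simp only [symLayer_concat]
      exact (ih k hkC _).plug _ _
    · -- the new output
      have hkk : k = Cs.length := by omega
      subst hkk
      have e1 : (symLayer (Cs ++ [C])).2[Cs.length]'hk' = (plug (symLayer Cs).1 Sum.inl C).2 := by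
        simp only [symLayer_concat]
        rw [List.getElem_append_right (by rw [hlen2])]
        simp [hlen2]
      have e2 : (Cs ++ [C])[Cs.length]'(by simp) = C := by simp
      rw [e1, e2]
      simp only [symLayer_concat]
      simpa using carries_plug C (f := fun k x => x k) (d := 0) fun k => carries_input (symLayer Cs).1 k

/-- **Symmetry of the layer**: all output wires are fixed. [folklore] -/
theorem symFix_symLayer (Cs : List (Circuit (Fin m × Fin m))) (hS : ∀ C ∈ Cs, C.IsSymmetricUnder Γ) :
    SymFix Γ (symLayer Cs).1 {w | w ∈ (symLayer Cs).2} := by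
  induction Cs using List.reverseRecOn with
  | nil => simpa [symLayer] using (symFix_nil (Γ := Γ))
  | append_singleton Cs C ih =>
    have h1 := (ih fun C' hC' => hS C' (List.mem_append_left _ hC')).plug_symmetric (wf_symLayer Cs)
      (hS C (List.mem_append_right _ (List.mem_singleton_self _)))
    rw [symLayer_concat]
    refine h1.mono fun w hw => ?_
    simp only [Set.mem_setOf_eq, List.mem_append, List.mem_singleton] at hw
    rcases hw with hw | hw
    · exact Or.inl hw
    · exact Or.inr (Set.mem_singleton_iff.2 hw)

/-- **Symmetric circuits are closed under post-composition with general circuits.** If each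
`C i` (`i < r`) is a `Γ`-symmetric circuit over `B` with at most `s` gates computing `f i`, and `D`
is ANY circuit over `B` on `r` inputs computing `h`, then `x ↦ h (f₀ x, …, f_{r-1} x)` has a
`Γ`-symmetric circuit over `B` with at most `r * s + |D|` gates: lay the `C i` side by side and plug
`D` on their (automorphism-fixed) outputs; the automorphism extending `ρ ∈ Γ` is `σ₀ ⊕ ⋯ ⊕ σ_{r-1} ⊕ id`.
This is the idiom "a general circuit on invariant wires stays symmetric" of every upper-bound
construction in the symmetry window (Anderson–Dawar 2017, §2). [cite: AndersonDawar2016, §2] -/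
theorem hasSymCircuit_postcompose {B : Set GateFn} {r s : ℕ} (C : Fin r → Circuit (Fin m × Fin m))
    (f : Fin r → (Fin m × Fin m → Bool) → Bool) (hB : ∀ i, (C i).IsOver B)
    (hS : ∀ i, (C i).IsSymmetricUnder Γ) (hs : ∀ i, (C i).size ≤ s) (hf : ∀ i, (C i).Computes (f i))
    (D : Circuit (Fin r)) (hDB : D.IsOver B) {h : (Fin r → Bool) → Bool} (hD : D.Computes h) :
    HasSymCircuit B Γ (r * s + D.size) (fun x => h fun i => f i x) := by
  -- the layer
  set L := symLayer (List.ofFn C) with hL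
  have hlenC : (List.ofFn C).length = r := List.length_ofFn
  have hlen2 : L.2.length = r := by rw [hL, length_symLayer_snd, hlenC]
  have hwfL : WF L.1 := wf_symLayer _
  have hsymL : SymFix Γ L.1 {w | w ∈ L.2} := symFix_symLayer _ fun C' hC' => by
    obtain ⟨i, rfl⟩ := List.mem_ofFn.1 hC'
    exact hS i
  -- feeding wires of `D`
  let ρD : Fin r → (Fin m × Fin m) ⊕ ℕ := fun k => L.2[k]'(by rw [hlen2]; exact k.2)
  have hρD : ∀ k, ρD k ∈ {w | w ∈ L.2} := fun k => List.getElem_mem _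
  have hcar : ∀ k : Fin r, Carries L.1 (ρD k) (C k).eval (C k).acDepth := fun k => by
    have := carries_symLayer (List.ofFn C) k (by rw [hlenC]; exact k.2) (by rw [hlen2]; exact k.2)
    simp only [List.getElem_ofFn, Fin.eta] at this
    exact this
  -- plug `D`
  have hsymP := hsymL.plug_general hwfL D hρD
  have hwfP : WF (plug L.1 ρD D).1 := wf_plug hwfL (fun k n hn => (hcar k).outOK n hn) D
  have hcarP := carries_plug D (f := fun k => (C k).eval) (d := (List.ofFn fun k => (C k).acDepth).sum)
    (gs := L.1) (ρ := ρD) fun k => (hcar k).mono (List.le_sum_of_mem (by simp))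
  have hmem : (plug L.1 ρD D).2 ∈ ({w | w ∈ L.2} ∪ {(plug L.1 ρD D).2} : Set _) :=
    Or.inr (Set.mem_singleton _)
  refine ⟨toCircuit (plug L.1 ρD D).1 (plug L.1 ρD D).2 hwfP (hsymP.1 _ hmem), ?_, ?_, ?_, ?_⟩
  · -- basis
    refine isOver_toCircuit hwfP _ (fn_mem_plug (fn_mem_symLayer _ fun C' hC' => ?_) ρD hDB)
    obtain ⟨i, rfl⟩ := List.mem_ofFn.1 hC'
    exact hB i
  · -- size
    rw [size_toCircuit, length_plug, hL, length_symLayer_fst, List.map_ofFn]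
    refine Nat.add_le_add_right ?_ _
    have : (List.ofFn (Circuit.size ∘ C)).sum ≤ (List.ofFn (Circuit.size ∘ C)).length * s := by
      refine List.sum_le_card_nsmul _ _ fun x hx => ?_
      obtain ⟨i, rfl⟩ := List.mem_ofFn.1 hx
      exact hs i
    simpa [List.length_ofFn] using this
  · -- symmetry
    exact hsymP.isSymmetricUnder_toCircuit hmem hwfP
  · -- semantics
    intro x
    rw [eval_toCircuit hwfP hcarP x, hD]
    congr 1
    funext i
    exact hf i x

end Layer

end Literature.Computability.Complexity.GateList
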